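import Summits.CriticalPhenomena.SAWScalingLimit.Theorems.SAWDefectDecoherenceObservableToSLERCarvedReductionSqueezeInnerDisc
import HarnessLib

/-!
# The four-point lemma and the angle chart of the circle (piece (K4c) of stub 5a4″
# `stub_carvedReduction_squeezeSolid`)

Piece of stub 5a4″ `stub_carvedReduction_squeezeSolid`
(`TwoPieceAdmRestrictionLimit → MovingCarvingSqueezeP FatAnchoredClassZeroSolid`) of the line
`bridge-gate-renewal` (r11) of the crux `SAWDefectDecoherence.ObservableToSLER`
(stmt-CriticalPhenomena-14005; twin T-A `stub_carvedReduction_squeezeGeometry` of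
stmt-CriticalPhenomena-10472), contract `InnerApproximant`, clause (C2) (the boundary loop of the
inner domain is `η`-close to `D.boundary t - τ` PARAMETER BY PARAMETER).  The far boundary arcs
of `D - τ` are traced on the unit circle through the extension `ψ̄` of the uniformizer of the
limit bulk; that the two traces and the two gate preimages come in the cyclic order of `∂D` is,
without prime-end theory, the following elementary statement plus a continuous angle:

* `subset_or_subset_of_gap`, `four_point` — a continuous `f` on `[c, c + 1]` with values in the
  union of two disjoint open sets `B₀ ∪ B₁` off two disjoint compact intervals `[[p₁, p₂]]`,
  `[[p₃, p₄]] ⊆ (c, c + 1)`, with `f c, f (c + 1), f p₁, f p₄ ∈ B₀` and `f p₂, f p₃ ∈ B₁`, has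
  `p₁ < p₂ < p₃ < p₄` or `p₄ < p₃ < p₂ < p₁` (the images of the gaps are connected);
* `stub_carvedReduction_angleChart` (`exists_angleChart`) — for a unit vector `ζ₀`, a base
  angle `c` with `e c = ζ₀` (`e θ = e^{2πiθ}`) and an angle function `Ang`, continuous on
  `∂𝔻 ∖ {ζ₀}`, with `e (Ang z) = z` and `Ang z ∈ (c, c + 1)` there (`Complex.arg` composed with the
  rotation taking `ζ₀` to `-1`).

Sources: Ch. Pommerenke, Boundary Behaviour of Conformal Maps (1992), §2.4 (circular order of
accessible points); L. V. Ahlfors, Complex Analysis (1979), Ch. 1 §2 (the argument).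
-/

noncomputable section
open Set Filter Metric Topology Complex Real Function
open Literature.Probability.RandomPlanarGeometry

namespace Summit.CriticalPhenomena.SAWScalingLimit.Theorems.ObservableToSLER.Squeeze

/-! ### Real-line bookkeeping: images of gaps and the four-point lemma -/

/-- A continuous map on `[u, v]` with values in the union of two disjoint open sets maps the whole
interval into one of them. -/
theorem subset_or_subset_of_gap {f : ℝ → ℂ} {u v : ℝ} (hf : ContinuousOn f (Icc u v))
    {B₀ B₁ : Set ℂ} (hB₀ : IsOpen B₀) (hB₁ : IsOpen B₁) (hdisj : Disjoint B₀ B₁)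
    (hcov : ∀ θ ∈ Icc u v, f θ ∈ B₀ ∪ B₁) : f '' Icc u v ⊆ B₀ ∨ f '' Icc u v ⊆ B₁ :=
  (isPreconnected_Icc.image f hf).subset_or_subset hB₀ hB₁ hdisj (image_subset_iff.2 hcov)

/-- **The four-point lemma.**  Let `f` be continuous on `[c, c + 1]`, with values in `B₀ ∪ B₁`
(disjoint open sets) outside `[[p₁, p₂]] ∪ [[p₃, p₄]]`, these two compact intervals being disjoint
and inside `(c, c + 1)`; suppose `f c, f (c + 1), f p₁, f p₄ ∈ B₀` and `f p₂, f p₃ ∈ B₁`.  Then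
`p₁ < p₂ < p₃ < p₄` or `p₄ < p₃ < p₂ < p₁`. -/
theorem four_point {f : ℝ → ℂ} {c p₁ p₂ p₃ p₄ : ℝ} (hf : ContinuousOn f (Icc c (c + 1)))
    {B₀ B₁ : Set ℂ} (hB₀ : IsOpen B₀) (hB₁ : IsOpen B₁) (hdisj : Disjoint B₀ B₁)
    (hp₁ : p₁ ∈ Ioo c (c + 1)) (hp₂ : p₂ ∈ Ioo c (c + 1)) (hp₃ : p₃ ∈ Ioo c (c + 1))
    (hp₄ : p₄ ∈ Ioo c (c + 1))
    (hJ : max p₁ p₂ < min p₃ p₄ ∨ max p₃ p₄ < min p₁ p₂)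
    (hZ : ∀ θ ∈ Icc c (c + 1), f θ ∉ B₀ ∪ B₁ → θ ∈ uIcc p₁ p₂ ∪ uIcc p₃ p₄)
    (hc0 : f c ∈ B₀) (hc1 : f (c + 1) ∈ B₀) (h1 : f p₁ ∈ B₀) (h4 : f p₄ ∈ B₀) (h2 : f p₂ ∈ B₁)
    (h3 : f p₃ ∈ B₁) :
    (p₁ < p₂ ∧ p₂ < p₃ ∧ p₃ < p₄) ∨ (p₄ < p₃ ∧ p₃ < p₂ ∧ p₂ < p₁) := by
  have hne : ∀ x, f x ∈ B₀ → f x ∈ B₁ → False := fun x h0 h1' => disjoint_left.1 hdisj h0 h1'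
  -- the gap step: on `[u, v]` free of the two intervals in its interior, `f u ∈ B₀ → f v ∈ B₀`
  have gap : ∀ u v : ℝ, c ≤ u → u ≤ v → v ≤ c + 1 →
      (∀ θ ∈ Ioo u v, θ ∉ uIcc p₁ p₂ ∪ uIcc p₃ p₄) → f u ∈ B₀ ∪ B₁ → f v ∈ B₀ ∪ B₁ →
      f u ∈ B₀ → f v ∈ B₀ := by
    intro u v hcu huv hvc hfree hu hv hu0
    have hcov : ∀ θ ∈ Icc u v, f θ ∈ B₀ ∪ B₁ := by
      intro θ hθ
      rcases hθ.1.eq_or_lt with rfl | hlt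
      · exact hu
      rcases hθ.2.eq_or_lt with rfl | hlt'
      · exact hv
      by_contra hnot
      exact hfree θ ⟨hlt, hlt'⟩ (hZ θ ⟨hcu.trans hθ.1, hθ.2.trans hvc⟩ hnot)
    rcases subset_or_subset_of_gap (hf.mono (Icc_subset_Icc hcu hvc)) hB₀ hB₁ hdisj hcov with
      h | h
    · exact h ⟨v, right_mem_Icc.2 huv, rfl⟩
    · exact (hne u hu0 (h ⟨u, left_mem_Icc.2 huv, rfl⟩)).elim
  rcases hJ with hA | hB
  · -- case A: `[[p₁,p₂]]` below `[[p₃,p₄]]`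
    left
    have hlow : f (min p₁ p₂) ∈ B₀ := by
      refine gap c (min p₁ p₂) le_rfl (le_min hp₁.1.le hp₂.1.le)
        ((min_le_left _ _).trans hp₁.2.le) (fun θ hθ hmem => ?_) (Or.inl hc0) ?_ hc0
      · rcases hmem with h | h
        · exact (not_le.2 hθ.2) h.1
        · exact (not_le.2 hθ.2) ((min_le_max).trans (hA.le.trans h.1))
      · rcases min_choice p₁ p₂ with h | h <;> rw [h]
        · exact Or.inl h1
        · exact Or.inr h2
    have h12 : p₁ < p₂ := by
      rcases lt_or_ge p₁ p₂ with h | h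
      · exact h
      · rw [min_eq_right h] at hlow; exact (hne _ hlow h2).elim
    have hhigh : f (max p₃ p₄) ∈ B₀ := by
      by_contra hnot
      have hmem : f (max p₃ p₄) ∈ B₀ ∪ B₁ := by
        rcases max_choice p₃ p₄ with h | h <;> rw [h]
        · exact Or.inr h3
        · exact Or.inl h4
      have hB₁mem : f (max p₃ p₄) ∈ B₁ := hmem.resolve_left hnot
      -- run the gap step on `[max p₃ p₄, c+1]` with the roles of `B₀`, `B₁` exchanged
      have hcov : ∀ θ ∈ Icc (max p₃ p₄) (c + 1), f θ ∈ B₀ ∪ B₁ := by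
        intro θ hθ
        rcases hθ.1.eq_or_lt with rfl | hlt
        · exact hmem
        rcases hθ.2.eq_or_lt with rfl | hlt'
        · exact Or.inl hc1
        by_contra hnot'
        rcases hZ θ ⟨(le_max_left _ _).trans' hp₃.1.le |>.trans hθ.1, hθ.2⟩ hnot' with h | h
        · exact (not_le.2 hlt) (h.2.trans (hA.le.trans min_le_max))
        · exact (not_le.2 hlt) h.2
      rcases subset_or_subset_of_gap (hf.mono (Icc_subset_Icc ((le_max_left _ _).trans'
        hp₃.1.le) le_rfl)) hB₀ hB₁ hdisj hcov with h | h
      · exact hnot (h ⟨_, left_mem_Icc.2 ((max_le hp₃.2.le hp₄.2.le)), rfl⟩)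
      · exact hne _ hc1 (h ⟨_, right_mem_Icc.2 (max_le hp₃.2.le hp₄.2.le), rfl⟩)
    have h34 : p₃ < p₄ := by
      rcases lt_or_ge p₃ p₄ with h | h
      · exact h
      · rw [max_eq_left h] at hhigh; exact (hne _ hhigh h3).elim
    refine ⟨h12, ?_, h34⟩
    have := hA
    rw [max_eq_right h12.le, min_eq_left h34.le] at this
    exact this
  · -- case B: `[[p₃,p₄]]` below `[[p₁,p₂]]`
    right
    have hlow : f (min p₃ p₄) ∈ B₀ := by
      refine gap c (min p₃ p₄) le_rfl (le_min hp₃.1.le hp₄.1.le)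
        ((min_le_left _ _).trans hp₃.2.le) (fun θ hθ hmem => ?_) (Or.inl hc0) ?_ hc0
      · rcases hmem with h | h
        · exact (not_le.2 hθ.2) ((min_le_max).trans (hB.le.trans h.1))
        · exact (not_le.2 hθ.2) h.1
      · rcases min_choice p₃ p₄ with h | h <;> rw [h]
        · exact Or.inr h3
        · exact Or.inl h4
    have h43 : p₄ < p₃ := by
      rcases lt_or_ge p₄ p₃ with h | h
      · exact h
      · rw [min_eq_left h] at hlow; exact (hne _ hlow h3).elim
    have hhigh : f (max p₁ p₂) ∈ B₀ := by
      by_contra hnot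
      have hmem : f (max p₁ p₂) ∈ B₀ ∪ B₁ := by
        rcases max_choice p₁ p₂ with h | h <;> rw [h]
        · exact Or.inl h1
        · exact Or.inr h2
      have hcov : ∀ θ ∈ Icc (max p₁ p₂) (c + 1), f θ ∈ B₀ ∪ B₁ := by
        intro θ hθ
        rcases hθ.1.eq_or_lt with rfl | hlt
        · exact hmem
        rcases hθ.2.eq_or_lt with rfl | hlt'
        · exact Or.inl hc1
        by_contra hnot'
        rcases hZ θ ⟨(le_max_left _ _).trans' hp₁.1.le |>.trans hθ.1, hθ.2⟩ hnot' with h | h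
        · exact (not_le.2 hlt) h.2
        · exact (not_le.2 hlt) (h.2.trans (hB.le.trans min_le_max))
      rcases subset_or_subset_of_gap (hf.mono (Icc_subset_Icc ((le_max_left _ _).trans'
        hp₁.1.le) le_rfl)) hB₀ hB₁ hdisj hcov with h | h
      · exact hnot (h ⟨_, left_mem_Icc.2 ((max_le hp₁.2.le hp₂.2.le)), rfl⟩)
      · exact hne _ hc1 (h ⟨_, right_mem_Icc.2 (max_le hp₁.2.le hp₂.2.le), rfl⟩)
    have h21 : p₂ < p₁ := by
      rcases lt_or_ge p₂ p₁ with h | h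
      · exact h
      · rw [max_eq_right h] at hhigh; exact (hne _ hhigh h2).elim
    refine ⟨h43, ?_, h21⟩
    have := hB
    rw [max_eq_left h43.le, min_eq_right h21.le] at this
    exact this

/-! ### A continuous angle on the circle minus one point -/

/-- **Angle chart based at `ζ₀`.**  For a unit vector `ζ₀` there are `c` with `e c = ζ₀` and a
function `Ang`, continuous on `∂𝔻 ∖ {ζ₀}`, with `e (Ang z) = z` and `Ang z ∈ (c, c + 1)` for every
unit vector `z ≠ ζ₀`. -/
theorem exists_angleChart {ζ₀ : ℂ} (hζ₀ : ‖ζ₀‖ = 1) :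
    ∃ (c : ℝ) (Ang : ℂ → ℝ), circleMap 0 1 (2 * π * c) = ζ₀ ∧
      ContinuousOn Ang (sphere (0 : ℂ) 1 \ {ζ₀}) ∧
      ∀ z ∈ sphere (0 : ℂ) 1, z ≠ ζ₀ →
        circleMap 0 1 (2 * π * Ang z) = z ∧ Ang z ∈ Ioo c (c + 1) := by
  obtain ⟨c, -, hc⟩ := exists_circleMap_two_pi_eq hζ₀ 0
  set w : ℂ → ℂ := fun z => -(z * (starRingEnd ℂ) ζ₀) with hw
  refine ⟨c, fun z => c + 1 / 2 + arg (w z) / (2 * π), hc, ?_, ?_⟩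
  · -- continuity: `w z` avoids the negative real axis
    intro z hz
    have hz1 : ‖z‖ = 1 := mem_sphere_zero_iff_norm.1 hz.1
    have hwz : w z ∈ slitPlane := by
      rw [mem_slitPlane_iff]
      by_contra hnot
      push Not at hnot
      obtain ⟨hre, him⟩ := hnot
      -- `w z` is a unit vector with zero imaginary part and nonpositive real part: `w z = -1`
      have hnw : ‖w z‖ = 1 := by
        simp only [hw, norm_neg, norm_mul, Complex.norm_conj, hz1, hζ₀, mul_one]
      have hwre : (w z).re = -1 := by
        have h := Complex.sq_norm_sub_sq_re (w z)
        rw [him, hnw] at h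
        have : (w z).re ^ 2 = 1 := by nlinarith
        nlinarith
      have hw1 : w z = -1 := Complex.ext (by simp [hwre]) (by simp [him])
      have : z = ζ₀ := by
        have h2 : z * (starRingEnd ℂ) ζ₀ = 1 := by
          have := congrArg Neg.neg hw1
          simpa [hw] using this
        have h3 : z * ((starRingEnd ℂ) ζ₀ * ζ₀) = ζ₀ := by rw [← mul_assoc, h2, one_mul]
        rwa [Complex.conj_mul', show ((‖ζ₀‖ : ℂ)) ^ 2 = 1 by rw [hζ₀]; simp, mul_one] at h3
      exact hz.2 this
    have hcont : ContinuousAt (fun z => c + 1 / 2 + arg (w z) / (2 * π)) z :=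
      continuousAt_const.add (((continuousAt_arg hwz).comp
        (by fun_prop : Continuous w).continuousAt).div_const _)
    exact hcont.continuousWithinAt
  · intro z hz hne
    have hz1 : ‖z‖ = 1 := mem_sphere_zero_iff_norm.1 hz
    have hnw : ‖w z‖ = 1 := by
      simp only [hw, norm_neg, norm_mul, Complex.norm_conj, hz1, hζ₀, mul_one]
    constructor
    · -- `e (Ang z) = ζ₀ · (-1) · (w z) = z`
      have hexp : Complex.exp (arg (w z) * I) = w z := by
        have := norm_mul_exp_arg_mul_I (w z)
        rwa [hnw, Complex.ofReal_one, one_mul] at this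
      rw [circleMap_zero, Complex.ofReal_one, one_mul] at hc ⊢
      rw [show ((2 * π * (c + 1 / 2 + arg (w z) / (2 * π)) : ℝ) : ℂ) * I =
          ((2 * π * c : ℝ) : ℂ) * I + π * I + arg (w z) * I by
        push_cast; field_simp, Complex.exp_add, Complex.exp_add, exp_pi_mul_I, hexp, hc]
      simp only [hw]
      rw [mul_neg_one, mul_neg, neg_mul, neg_neg, mul_left_comm, Complex.mul_conj,
        Complex.normSq_eq_norm_sq, hζ₀]
      simp
    · -- `arg (w z) ∈ (-π, π)` since `w z ≠ -1`
      have hlt : arg (w z) < π := by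
        rw [arg_lt_pi_iff]
        by_contra hnot
        push Not at hnot
        obtain ⟨hre, him⟩ := hnot
        have hwre : (w z).re = -1 := by
          have h := Complex.sq_norm_sub_sq_re (w z)
          rw [him, hnw] at h
          have : (w z).re ^ 2 = 1 := by nlinarith
          nlinarith
        have hw1 : w z = -1 := Complex.ext (by simp [hwre]) (by simp [him])
        have h2 : z * (starRingEnd ℂ) ζ₀ = 1 := by
          have := congrArg Neg.neg hw1
          simpa [hw] using this
        have h3 : z * ((starRingEnd ℂ) ζ₀ * ζ₀) = ζ₀ := by rw [← mul_assoc, h2, one_mul]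
        rw [Complex.conj_mul', show ((‖ζ₀‖ : ℂ)) ^ 2 = 1 by rw [hζ₀]; simp, mul_one] at h3
        exact hne h3
      have hgt : -π < arg (w z) := neg_pi_lt_arg _
      have hπ : (0 : ℝ) < 2 * π := by positivity
      constructor
      · have : -(1 / 2 : ℝ) < arg (w z) / (2 * π) := by
          rw [lt_div_iff₀ hπ]; linarith
        linarith
      · have : arg (w z) / (2 * π) < 1 / 2 := by
          rw [div_lt_iff₀ hπ]; linarith
        linarith


/-- **Registered sub-goal `stub_carvedReduction_angleChart`** (crux item stmt-CriticalPhenomena-14005,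
stub 5a4″ `stub_carvedReduction_squeezeSolid`, piece (K4c) THE ANGLE CHART): for a unit vector
`ζ₀`, a base angle `c` with `e c = ζ₀` and an angle function continuous on `∂𝔻 ∖ {ζ₀}` inverting
`e` there with values in `(c, c + 1)`. [cite: AhlforsCA1979, Ch. 1 §2.1 (the argument of a complex number)] -/
theorem stub_carvedReduction_angleChart :
    ∀ (ζ₀ : ℂ), ‖ζ₀‖ = 1 →
      ∃ (c : ℝ) (Ang : ℂ → ℝ), circleMap 0 1 (2 * π * c) = ζ₀ ∧
        ContinuousOn Ang (sphere (0 : ℂ) 1 \ {ζ₀}) ∧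
        ∀ z ∈ sphere (0 : ℂ) 1, z ≠ ζ₀ →
          circleMap 0 1 (2 * π * Ang z) = z ∧ Ang z ∈ Ioo c (c + 1) := by
  intro ζ₀ hζ₀
  exact exists_angleChart hζ₀

end Summit.CriticalPhenomena.SAWScalingLimit.Theorems.ObservableToSLER.Squeeze

end
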